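import Mathlib
import HarnessLib
import Summits.HubbardSuperconductivity.HubbardSuperconductivity.Theorems.KLProgrammeC4aAliasingJetProduct

/-!
# Route `KLProgramme` — crux C4a / stub (C) «(C)-B-REP» sup route, (R59bl) part 3: THE GENERIC ALIASING-JET LEMMA assembled, and the quarter-tail
# from derivative bounds (`‖Dʲ[I_L[(g·P)∘p]](q)‖ ≤ ‖Dʲ(g·P)(q)‖ + 2·M_j(P̌)·G_j`, `G_j ≤ 3ʲ·D·(2π)^{−M}·(2/N)^{M−j−4}·4·C₂`)

Cell `gate-hubbard-kl`, lane hubbard-kl-c4a-1 (g4); pen (R59bl) (KL STATUS l.3734), p2 g13 spec HOME/p2-g13/SUP-ROUTE-SPEC-p2g13.md §2.  Parts 1–2: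
`…C4aSymbolCosSeries` (a smooth `D₄`-symmetric symbol is a `cosSeries`; p2 g6's aliasing bound in `ℤ²` currency) and `…C4aAliasingJetProduct`
(the `ℤ²` tail of `F = g·P` is `≤ M_j·G_j`).  Here:

* §3 **`norm_iteratedFDeriv_evalM_symInterp_mul_trigPoly_le`** — THE GENERIC LEMMA: `g` smooth `2π`-periodic, `P(q) = Σ_{x∈B} c_x cos(x·q)` with
  `4|xᵢ| ≤ L` on `B`, `F = g·P` reflection/swap-symmetric, `ĝ♭` weighted-summable at order `J` ⟹ for `j ≤ J`
  `‖Dʲ[evalM (symInterp L (F∘p))](q)‖ ≤ ‖Dʲ F(q)‖ + 2·(Σ_{x∈B}|c_x|(1+|x₀|+|x₁|)ʲ)·Σ'_η [∃ i, L/4 < |ηᵢ|] ‖ĝ♭(η)‖(1+|η₀|+|η₁|)ʲ`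
  (at a point where `g` vanishes to all orders — the consumer's case — the first term is `0`: pure aliasing);
* §4 `isSmooth_symbolFlat`, **`norm_partialDeriv_iterate_symbolFlat_le`** (plane-to-flat: `‖D^M g‖ ≤ Dg ⟹ ‖∂ᵢ^M g♭‖ ≤ (2π)^M·Dg`),
  **`quarterTail_weighted_le`** (`G_j ≤ 3ʲ·(D/(2π)^M)·(2/N)^{M−j−4}·(4·Σ_k ∏ᵢ(1+kᵢ²)⁻¹)`, `N = 2(L/4+1)`, from `‖∂ᵢ^M g♭‖ ≤ D`, `4 + j ≤ M`;
  `Literature/Analysis/Fourier/TorusFourierTailSmooth` §2), `summable_weighted_symbolFlat_of_deriv` (the order-`J` weighted summability hypothesis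
  from `‖∂ᵢ^M g♭‖ ≤ D`, `4 + J ≤ M`).

Pure harmonic analysis; nothing is asserted about the Hubbard model.  References: Boyd 2001 §4.5 Thm 19–20 [cite: Boyd2001]; Grafakos 2014 §3.3.3 [cite: Grafakos2014].
-/

noncomputable section

namespace Summit.HubbardSuperconductivity.HubbardSuperconductivity.Theorems.C4a

set_option linter.dupNamespace false -- summit = problem name (single-conjunct summit), D-0017

open Real Set MeasureTheory UnitAddTorus Finset
open Literature.Probability.LatticeModels Literature.MathematicalPhysics.QuantumLattice
open Literature.Analysis.Fourier Literature.Analysis.FunctionSpaces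
open Summit.HubbardSuperconductivity.HubbardSuperconductivity.Theorems.KLRegimeSplit


/-! ## §3 THE GENERIC ALIASING-JET LEMMA -/

section Generic

variable {L : ℕ} {g : Momentum → ℝ} (hgper : ∀ (j : Fin 2) (q : Momentum), g (q + EuclideanSpace.single j (2 * π)) = g q)
  (hg : ContDiff ℝ (⊤ : ℕ∞) g) (B : Finset (Fin 2 → ℤ)) (c : (Fin 2 → ℤ) → ℝ) (hB : ∀ x ∈ B, ∀ i, 4 * |x i| ≤ (L : ℤ))
  {P : Momentum → ℝ} (hP : ∀ q : Momentum, P q = ∑ x ∈ B, c x * Real.cos (∑ i : Fin 2, (x i : ℝ) * q i))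
include hg hB hP


/-- **THE GENERIC ALIASING-JET LEMMA (R59bl).**  `g` smooth `2π`-periodic, `P(q) = Σ_{x∈B} c_x cos(x·q)` with `4|xᵢ| ≤ L` on `B` (resolved by the grid),
`F = g·P` reflection- and swap-symmetric, and `ĝ♭` weighted-summable at order `J`.  Then for `j ≤ J` at every continuum momentum `q`:
`‖Dʲ[evalM (symInterp L (F∘p))](q)‖ ≤ ‖Dʲ F(q)‖ + 2·(Σ_{x∈B}|c_x|(1+|x₀|+|x₁|)ʲ)·Σ'_η [∃ i, L/4 < |ηᵢ|] ‖ĝ♭(η)‖(1+|η₀|+|η₁|)ʲ`.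
At a point where `g` vanishes to all orders (the consumer's case) the first term is `0`: pure aliasing. -/
theorem norm_iteratedFDeriv_evalM_symInterp_mul_trigPoly_le [NeZero L]
    (hrefl : ∀ p : Fin 2 → ℝ, (fun q => g q * P q) (WithLp.toLp 2 ![p 0, -p 1]) = (fun q => g q * P q) (WithLp.toLp 2 p))
    (hswap : ∀ p : Fin 2 → ℝ, (fun q => g q * P q) (WithLp.toLp 2 ![p 1, p 0]) = (fun q => g q * P q) (WithLp.toLp 2 p))
    {J : ℕ} (hwg : Summable fun η : Fin 2 → ℤ => ‖mFourierCoeff (symbolFlat g hgper) η‖ * (1 + ∑ i : Fin 2, |((η i : ℤ) : ℝ)|) ^ J)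
    {j : ℕ} (hj : j ≤ J) (q : Momentum) :
    ‖iteratedFDeriv ℝ j (evalM (symInterp L (fun k : TorusSite 2 L => (fun q => g q * P q) (WithLp.toLp 2 (latticeMomentum L k))))) q‖ ≤
      ‖iteratedFDeriv ℝ j (fun q => g q * P q) q‖ +
        2 * ((∑ x ∈ B, |c x| * (1 + |((x 0 : ℤ) : ℝ)| + |((x 1 : ℤ) : ℝ)|) ^ j) *
          ∑' η : Fin 2 → ℤ, (if ∃ i, L / 4 < (η i).natAbs then
            ‖mFourierCoeff (symbolFlat g hgper) η‖ * (1 + ∑ i : Fin 2, |((η i : ℤ) : ℝ)|) ^ j else 0)) := by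
  have hP' : ContDiff ℝ (⊤ : ℕ∞) P := by
    have hfun : P = fun q : Momentum => ∑ x ∈ B, c x * Real.cos (∑ i : Fin 2, (x i : ℝ) * q i) := funext hP
    rw [hfun]
    refine ContDiff.sum fun x _ => contDiff_const.mul (Real.contDiff_cos.comp (ContDiff.sum fun i _ => contDiff_const.mul ?_))
    exact (EuclideanSpace.proj (𝕜 := ℝ) i).contDiff
  have hF : ContDiff ℝ (⊤ : ℕ∞) (fun q => g q * P q) := hg.mul hP'
  have hwF := summable_weighted_symbolFlat_mul_trigPoly hgper hg B c hP J hwg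
  have h1 := norm_iteratedFDeriv_evalM_symInterp_symbol_le (mul_trigPoly_periodic hgper B c hP) hF hrefl hswap (L := L) hwF hj q
  have hwgj : Summable fun η : Fin 2 → ℤ => ‖mFourierCoeff (symbolFlat g hgper) η‖ * (1 + ∑ i : Fin 2, |((η i : ℤ) : ℝ)|) ^ j := by
    refine Summable.of_nonneg_of_le (fun η => by positivity) (fun η => mul_le_mul_of_nonneg_left ?_ (norm_nonneg _)) hwg
    exact pow_le_pow_right₀ (le_add_of_nonneg_right (Finset.sum_nonneg fun i _ => abs_nonneg _)) hj
  have h2 := ztail_symbolFlat_mul_trigPoly_le hgper hg B c hB hP j hwgj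
  linarith

end Generic


/-! ## §4 The quarter-tail from derivative bounds on the flat symbol, and the plane-to-flat conversion -/

section QuarterTail

variable {L : ℕ} {g : Momentum → ℝ} (hgper : ∀ (j : Fin 2) (q : Momentum), g (q + EuclideanSpace.single j (2 * π)) = g q)
  (hg : ContDiff ℝ (⊤ : ℕ∞) g)
include hg

/-- The flat symbol of a smooth symbol is smooth on the torus. -/
theorem isSmooth_symbolFlat : Torus.IsSmooth (symbolFlat g hgper) := by
  unfold symbolFlat
  exact isSmooth_descend _ _ ((Complex.ofRealCLM.contDiff.comp hg).comp (contDiff_const_smul (2 * π)))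

/-- **Plane-to-flat conversion of derivative bounds**: `‖D^M g‖ ≤ Dg` on the plane gives `‖∂ᵢ^M g♭‖ ≤ (2π)^M·Dg` on the torus. -/
theorem norm_partialDeriv_iterate_symbolFlat_le {M : ℕ} {Dg : ℝ} (hDg : ∀ q : Momentum, ‖iteratedFDeriv ℝ M g q‖ ≤ Dg) (i : Fin 2)
    (t : UnitAddTorus (Fin 2)) : ‖((Torus.partialDeriv i)^[M] (symbolFlat g hgper)) t‖ ≤ (2 * π) ^ M * Dg := by
  have hDg0 : 0 ≤ Dg := le_trans (norm_nonneg _) (hDg 0)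
  unfold symbolFlat
  refine norm_partialDeriv_iterate_descend_le ((Complex.ofRealCLM.contDiff.comp hg).comp (contDiff_const_smul (2 * π)))
    (isLatticePeriodic_symbol hgper) i M (fun y => ?_) t
  -- `y ↦ (g ((2π)•y) : ℂ) = ofRealCLM ∘ g ∘ ((2π) • id)`
  set A : Momentum →L[ℝ] Momentum := (2 * π) • ContinuousLinearMap.id ℝ Momentum with hA
  have hcomp : ((⇑Complex.ofRealCLM ∘ g) ∘ fun p : Momentum => (2 * π) • p) = (fun q => Complex.ofRealCLM (g q)) ∘ A := by
    funext y; simp [hA]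
  have hgC : ContDiff ℝ (⊤ : ℕ∞) (fun q => Complex.ofRealCLM (g q)) := Complex.ofRealCLM.contDiff.comp hg
  show ‖iteratedFDeriv ℝ M ((fun q => Complex.ofRealCLM (g q)) ∘ A) y‖ ≤ (2 * π) ^ M * Dg
  rw [ContinuousLinearMap.iteratedFDeriv_comp_right A hgC y (by exact_mod_cast le_top)]
  refine (ContinuousMultilinearMap.norm_compContinuousLinearMap_le _ _).trans ?_
  rw [Finset.prod_const, Finset.card_univ, Fintype.card_fin]
  have hAn : ‖A‖ ≤ 2 * π := by
    rw [hA, norm_smul, Real.norm_eq_abs, abs_of_pos (by positivity)]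
    exact mul_le_of_le_one_right (by positivity) ContinuousLinearMap.norm_id_le
  have h1 : ‖iteratedFDeriv ℝ M (fun q => Complex.ofRealCLM (g q)) (A y)‖ ≤ Dg := by
    refine (ContinuousLinearMap.norm_iteratedFDeriv_comp_left Complex.ofRealCLM hg.contDiffAt (by exact_mod_cast le_top)).trans ?_
    rw [Complex.ofRealCLM_norm, one_mul]
    exact hDg _
  calc ‖iteratedFDeriv ℝ M (fun q => Complex.ofRealCLM (g q)) (A y)‖ * ‖A‖ ^ M ≤ Dg * (2 * π) ^ M :=
        mul_le_mul h1 (pow_le_pow_left₀ (norm_nonneg _) hAn M) (by positivity) hDg0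
    _ = (2 * π) ^ M * Dg := mul_comm _ _

/-- **The quarter-tail from flat derivative bounds**: with `‖∂ᵢ^M g♭‖ ≤ D` (`4 + j ≤ M`) and `N = 2(L/4 + 1)`,
`Σ'_η [∃ i, L/4 < |ηᵢ|] ‖ĝ♭(η)‖(1+Σ|ηᵢ|)ʲ ≤ 3ʲ·D·(2π)^{−M}·(2/N)^{M−j−4}·4·Σ_k ∏ᵢ(1+kᵢ²)⁻¹`
(`Literature.Analysis.Fourier.tsum_tail_norm_mFourierCoeff_mul_weight_le` at `d = Fin 2`). -/
theorem quarterTail_weighted_le {M j : ℕ} (hM : 4 + j ≤ M) {D : ℝ}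
    (hD : ∀ (i : Fin 2) (t : UnitAddTorus (Fin 2)), ‖((Torus.partialDeriv i)^[M] (symbolFlat g hgper)) t‖ ≤ D) :
    ∑' η : Fin 2 → ℤ, (if ∃ i, L / 4 < (η i).natAbs then
        ‖mFourierCoeff (symbolFlat g hgper) η‖ * (1 + ∑ i : Fin 2, |((η i : ℤ) : ℝ)|) ^ j else 0) ≤
      (3 : ℝ) ^ j * (D / (2 * π) ^ M) * (2 / ((2 * (L / 4 + 1) : ℕ) : ℝ)) ^ (M - j - 4) *
        (2 ^ 2 * ∑' k : Fin 2 → ℤ, ∏ i, (1 + (k i : ℝ) ^ 2)⁻¹) := by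
  classical
  have h := tsum_tail_norm_mFourierCoeff_mul_weight_le (d := Fin 2) (isSmooth_symbolFlat hgper hg) (M := M) (j := j)
    (by simp only [Fintype.card_fin]; omega) hD (N := 2 * (L / 4 + 1)) (by omega)
  simp only [Fintype.card_fin] at h
  have hset : ∀ η : Fin 2 → ℤ, (∃ i, (((2 * (L / 4 + 1) : ℕ)) : ℤ) ≤ 2 * |η i|) ↔ ∃ i, L / 4 < (η i).natAbs := by
    intro η
    refine exists_congr fun i => ?_
    have := Int.natCast_natAbs (η i)
    constructor
    · intro h1; zify; omega
    · intro h1; zify at h1; omega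
  have heq : (∑' η : Fin 2 → ℤ, (if ∃ i, L / 4 < (η i).natAbs then
        ‖mFourierCoeff (symbolFlat g hgper) η‖ * (1 + ∑ i : Fin 2, |((η i : ℤ) : ℝ)|) ^ j else 0)) =
      ∑' η : Fin 2 → ℤ, (if ∃ i, (((2 * (L / 4 + 1) : ℕ)) : ℤ) ≤ 2 * |η i| then
        ‖mFourierCoeff (symbolFlat g hgper) η‖ * (1 + ∑ i : Fin 2, |((η i : ℤ) : ℝ)|) ^ j else 0) := by
    refine tsum_congr fun η => ?_
    by_cases hη : ∃ i, L / 4 < (η i).natAbs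
    · rw [if_pos hη, if_pos ((hset η).2 hη)]
    · rw [if_neg hη, if_neg (mt (hset η).1 hη)]
  rw [heq]
  refine (le_of_eq (tsum_congr fun η => by congr)).trans (h.trans (le_of_eq ?_))
  norm_num

/-- **The order-`J` weighted summability of `ĝ♭` from flat derivative bounds** (`4 + J ≤ M`): the hypothesis `hwg` of the generic lemma. -/
theorem summable_weighted_symbolFlat_of_deriv {M J : ℕ} (hM : 4 + J ≤ M) {D : ℝ}
    (hD : ∀ (i : Fin 2) (t : UnitAddTorus (Fin 2)), ‖((Torus.partialDeriv i)^[M] (symbolFlat g hgper)) t‖ ≤ D) :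
    Summable fun η : Fin 2 → ℤ => ‖mFourierCoeff (symbolFlat g hgper) η‖ * (1 + ∑ i : Fin 2, |((η i : ℤ) : ℝ)|) ^ J := by
  classical
  have h1 := summable_tail_norm_mFourierCoeff_mul_weight (d := Fin 2) (isSmooth_symbolFlat hgper hg) (M := M) (j := J)
    (by simp only [Fintype.card_fin]; omega) hD (N := 1) le_rfl
  set f : (Fin 2 → ℤ) → ℝ := fun η => ‖mFourierCoeff (symbolFlat g hgper) η‖ * (1 + ∑ i : Fin 2, |((η i : ℤ) : ℝ)|) ^ J with hf
  have h2 : Summable fun η : Fin 2 → ℤ => if η = 0 then f 0 else 0 :=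
    summable_of_ne_finset_zero (s := {0}) fun η hη => if_neg (by simpa using hη)
  refine Summable.of_nonneg_of_le (fun η => by positivity) (fun η => ?_) (h1.add h2)
  by_cases hη : η = 0
  · subst hη
    simp only [Pi.zero_apply, abs_zero, mul_zero, Int.cast_zero, if_true]
    rw [if_neg (by simp)]
    simp [hf]
  · have hex : ∃ i, ((1 : ℕ) : ℤ) ≤ 2 * |η i| := by
      obtain ⟨i, hi⟩ : ∃ i, η i ≠ 0 := by
        by_contra h
        push Not at h
        exact hη (funext h)
      exact ⟨i, by have := Int.one_le_abs hi; push_cast; omega⟩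
    rw [if_pos hex, if_neg hη, add_zero]

end QuarterTail

end Summit.HubbardSuperconductivity.HubbardSuperconductivity.Theorems.C4a

end
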